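import Summits.QuantumFields.BalabanUV.Gaps.EndDrawdownModulusRoad
import Summits.QuantumFields.BalabanUV.Gaps.EndDrawdownLinearRoadStrict

/-!
# Gaps / EndDrawdownModulusStrict — NO REMAINDER MODULUS CAPTURES EVERY-SLOPE POSSIBILITY: for EVERY modulus `ω` (continuous, monotone, positive on
# `]0,∞[`, `ω(0⁺) = 0`) there is ONE explicit one-loop sequence — an `ω`-ADAPTED DYADIC STAIRCASE `b_j = −1∕2^{t(j)}`, rate halving from block to block,
# block `t` of length `L_t` chosen so long that its budget `L_t·2^{−t−1}` exceeds the next threshold `T_{t+1} := 1∕s_{t+1}²` where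
# `(t+2)·ω(s_{t+1}) ≤ 2^{−t−2}` — with bounded drawdown below EVERY negative line (hence POSSIBLE over the every-slope class on every box) and yet
# `¬ EndPossibleMod b (C·ω) γ₀` for EVERY `C > 0` and every box: no realization whose remainder obeys `|β¹_{k+1}| ≤ C·ω(g_k)` has
# `EndpointExistence`.  Mechanism = `EndDrawdownLinearRoadStrict`'s block descent with arbitrary block lengths: along an in-box run the forward-generated
# one-sided steps `1∕g_i² ≤ 1∕g_{i+1}² + b_i + C ω(g_i)` give, on block `t ≥ ⌈C⌉`, help `≤ 2^{−t−1}` (half the rate) whenever `1∕g_i² ≥ T_t`, so `1∕g²`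
# descends or dips below `T_t` and stays; from a block boundary above the target down to block `t₀` this ends at `1∕g² < T_{t₀}`, outside the box
# `]0, s_{t₀}]`.  With `EndDrawdownModulusRoad` (forcing is modulus-free) this completes: at END grade EVERY modulus road has the every-slope FORCING
# threshold and a STRICTLY STRONGER POSSIBILITY threshold (this seat's own leaf; cell pub-balaban-gaps, seat g1-p3 GEN 9, rows CAP ∕ tail ∕ (D4) «split ∕
# weakening»; file 16 of «the one-loop interface of the END statement»)

HONEST FRAMING (cell rule, page 1 of everything): [folklore] window arithmetic along in-interval runs of forward-generated constructions for an
explicit TOY one-loop sequence built from the modulus; `EndPossibleMod` is a quantified READING of the cell's END-grade statement over Bałaban-free data,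
not a binder; modulus classes are hypothesis SHAPES of row (D4)'s remainder; nothing of Bałaban's table is certified (NODE-O 0∕1); words ∕ odds
UNCHANGED.  Nothing of Bałaban's is asserted; 0∕6 binders; one finite T⁴; NOT [I] Thm 2, NOT `BetaPertH`, NOT the continuum limit, NOT Clay.

CITATION HEADER (tags CONTEXT ONLY).  [I] = T. Bałaban, Commun. Math. Phys. **109** (1987) 249–301 [Balaban1987RG1]: (0.20) p. 256, Thm 2
p. 259 (first sentence), Thm 3 p. 264, (2.12)–(2.14) p. 268.
-/

namespace Summit.QuantumFields.BalabanUV.Gaps.EndDrawdownModulusStrict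

open Literature.MathematicalPhysics.QuantumFieldTheory.Balaban1983to89
open Literature.MathematicalPhysics.QuantumFieldTheory.Balaban1983to89.FlowStep
open Literature.MathematicalPhysics.QuantumFieldTheory.Balaban1983to89.FlowStepRuns
open Literature.MathematicalPhysics.QuantumFieldTheory.Balaban1983to89.DagBinding
open Summit.QuantumFields.BalabanUV.Gaps.CapSignsNecessaryFwd (step_ge_of_forwardGenerated)
open Summit.QuantumFields.BalabanUV.Gaps.EndDrawdownSeq
open Summit.QuantumFields.BalabanUV.Gaps.EndDrawdownEverySlope
open Summit.QuantumFields.BalabanUV.Gaps.EndDrawdownEverySlopeDecided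
open Summit.QuantumFields.BalabanUV.Gaps.EndDrawdownLinearRoadStrict (chain_descent)
open Summit.QuantumFields.BalabanUV.Gaps.EndDrawdownModulusRoad
open Finset

noncomputable section

/-! ## §1 The quantified existential reading over a modulus class -/

/-- QUANTIFIED READING (existential) over the MODULUS class · SOME realization of `b` with `|β¹_{k+1}(p)| ≤ ω(p_k)` on the `]0,γ₀]`-histories, (C) on
`]0,γ₀]`, a forward-generated construction, has E. [cite: Balaban1987RG1, Thm 2 p.259 (first sentence) and (2.12)–(2.14) p.268] -/
def EndPossibleMod (b : ℕ → ℝ) (ω : ℝ → ℝ) (γ₀ : ℝ) : Prop :=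
  ∃ (β : HBeta) (Sβ : B12Beta.OneLoopSplit β) (Cn : B12.Construction), (∀ j, Sβ.β0 j = b j) ∧
    (∀ (k : ℕ) (p : Fin (k + 1) → ℝ), p ∈ B12Beta.HistBox γ₀ k → |Sβ.β1 k p| ≤ ω (p (Fin.last k))) ∧
      BetaContH γ₀ β ∧ ForwardGenerated Cn β ∧ EndpointExistence Cn

/-- POSSIBLE over a modulus class ⟹ POSSIBLE over the every-slope class (`0 < γ₀`). [cite: Balaban1987RG1, Thm 3 p.264] -/
theorem endPossibleES_of_endPossibleMod {b : ℕ → ℝ} {ω : ℝ → ℝ} (hω : IsModulus ω) {γ₀ : ℝ} (hγ₀ : 0 < γ₀) (h : EndPossibleMod b ω γ₀) :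
    EndPossibleES b γ₀ := by
  obtain ⟨β, Sβ, Cn, hb, hM, hcont, hgen, hE⟩ := h
  exact ⟨β, Sβ, Cn, hb, everySlope_of_modulus Sβ hω hγ₀ hM, hcont, hgen, hE⟩

/-- A positive multiple of a modulus is a modulus. [folklore] -/
theorem isModulus_smul {ω : ℝ → ℝ} (hω : IsModulus ω) {C : ℝ} (hC : 0 < C) : IsModulus (fun x => C * ω x) := by
  refine ⟨continuousOn_const.mul hω.cont, fun x y hx hxy => mul_le_mul_of_nonneg_left (hω.mono x y hx hxy) hC.le,
    fun x hx => mul_pos hC (hω.pos x hx), fun s hs => ?_⟩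
  obtain ⟨γ, hγ, hγs⟩ := hω.small (s / C) (by positivity)
  exact ⟨γ, hγ, by rw [← le_div_iff₀' hC]; exact hγs⟩

/-! ## §2 One block of the descent, with arbitrary block length -/

/-- **ONE BLOCK OF THE DESCENT (arbitrary length)** · on the indices `[lo, hi)` a real sequence with `y_i ≤ y_{i+1} − ε + h_i`, help `h_i ≤ ε∕2` whenever
`T ≤ y_i` (`T > 0`), budget `(hi − lo)·ε∕2 ≥ E` and entering value `y_hi < E`: then `y_lo < T`. [folklore] -/
theorem block_descent_gen {y h : ℕ → ℝ} {lo hi : ℕ} (hlh : lo ≤ hi) {ε T E : ℝ} (hT : 0 < T) (hε : 0 < ε)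
    (hstep : ∀ i, lo ≤ i → i < hi → y i ≤ y (i + 1) - ε + h i) (hhelp : ∀ i, lo ≤ i → i < hi → T ≤ y i → h i ≤ ε / 2)
    (hbudget : E ≤ ((hi : ℝ) - lo) * (ε / 2)) (henter : y hi < E) : y lo < T := by
  have hstay : ∀ d i, i + d ≤ hi → lo ≤ i → y (i + d) < T → y i < T := by
    intro d
    induction d with
    | zero => intro i _ _ hy; simpa using hy
    | succ d ih =>
      intro i hid hloi hy
      have h1 : y (i + 1) < T := ih (i + 1) (by omega) (by omega) (by rw [show i + 1 + d = i + (d + 1) by omega]; exact hy)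
      by_contra hge
      have hs := hstep i hloi (by omega)
      have hh := hhelp i hloi (by omega) (not_lt.mp hge)
      linarith
  have hdip : ∃ i, lo ≤ i ∧ i ≤ hi ∧ y i < T := by
    by_contra hno
    simp only [not_exists, not_and, not_lt] at hno
    have hdesc : ∀ i, lo ≤ i → i < hi → y i ≤ y (i + 1) - ε / 2 := by
      intro i h1 h2
      have hs := hstep i h1 h2
      have hh := hhelp i h1 h2 (hno i h1 h2.le)
      linarith
    have hch := chain_descent hlh hdesc
    have hlo_ge := hno lo le_rfl hlh
    linarith
  obtain ⟨i, hloi, hihi, hyi⟩ := hdip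
  obtain ⟨d, rfl⟩ := Nat.exists_eq_add_of_le hloi
  exact hstay d lo (by omega) le_rfl hyi

/-! ## §3 The `ω`-adapted staircase -/

section Stair

variable {ω : ℝ → ℝ} (hω : IsModulus ω)
include hω

/-- The coupling threshold of block `t`: a point `s_t ∈ ]0, 1∕(t+1)]` with `(t+1)·ω(s_t) ≤ 2^{−t−1}` (exists since `ω(0⁺) = 0`). [folklore] -/
theorem exists_sMod (t : ℕ) : ∃ s : ℝ, 0 < s ∧ s ≤ 1 / ((t : ℝ) + 1) ∧ ((t : ℝ) + 1) * ω s ≤ (2 : ℝ)⁻¹ ^ (t + 1) := by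
  obtain ⟨γ, hγ, hγs⟩ := hω.small ((2 : ℝ)⁻¹ ^ (t + 1) / ((t : ℝ) + 1)) (by positivity)
  refine ⟨min γ (1 / ((t : ℝ) + 1)), lt_min hγ (by positivity), min_le_right _ _, ?_⟩
  have h1 : ω (min γ (1 / ((t : ℝ) + 1))) ≤ ω γ := hω.mono _ _ (lt_min hγ (by positivity)) (min_le_left _ _)
  have h2 : ((t : ℝ) + 1) * ω γ ≤ (2 : ℝ)⁻¹ ^ (t + 1) := by rwa [← le_div_iff₀' (by positivity)]
  nlinarith [h1, h2, (Nat.cast_nonneg t : (0 : ℝ) ≤ t)]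

/-- The chosen threshold `s_t`. [folklore] -/
def sMod (t : ℕ) : ℝ := Classical.choose (exists_sMod hω t)

/-- Its specification. [folklore] -/
theorem sMod_spec (t : ℕ) : 0 < sMod hω t ∧ sMod hω t ≤ 1 / ((t : ℝ) + 1) ∧ ((t : ℝ) + 1) * ω (sMod hω t) ≤ (2 : ℝ)⁻¹ ^ (t + 1) :=
  Classical.choose_spec (exists_sMod hω t)

/-- The `1∕g²`-threshold of block `t`: `T_t := 1∕s_t²` (`≥ (t+1)²`, so unbounded). [folklore] -/
def TMod (t : ℕ) : ℝ := 1 / sMod hω t ^ 2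

/-- `0 < T_t`. [folklore] -/
theorem TMod_pos (t : ℕ) : 0 < TMod hω t := by
  have := (sMod_spec hω t).1; unfold TMod; positivity

/-- `(t+1)² ≤ T_t`. [folklore] -/
theorem sq_le_TMod (t : ℕ) : ((t : ℝ) + 1) ^ 2 ≤ TMod hω t := by
  obtain ⟨hs, hsle, -⟩ := sMod_spec hω t
  unfold TMod
  have h1 : sMod hω t ^ 2 ≤ (1 / ((t : ℝ) + 1)) ^ 2 := pow_le_pow_left₀ hs.le hsle 2
  calc ((t : ℝ) + 1) ^ 2 = 1 / (1 / ((t : ℝ) + 1)) ^ 2 := by rw [div_pow, one_pow, one_div_one_div]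
    _ ≤ 1 / sMod hω t ^ 2 := one_div_le_one_div_of_le (pow_pos hs 2) h1

/-- The block LENGTH of block `t`: `L_t := ⌈T_{t+1}·2^{t+1}⌉₊ + 1`, so that the budget `L_t · 2^{−t−1} ≥ T_{t+1}`. [folklore] -/
def LMod (t : ℕ) : ℕ := ⌈TMod hω (t + 1) * 2 ^ (t + 1)⌉₊ + 1

/-- `1 ≤ L_t`. [folklore] -/
theorem one_le_LMod (t : ℕ) : 1 ≤ LMod hω t := Nat.le_add_left 1 _

/-- THE BUDGET: `T_{t+1} ≤ L_t · 2^{−(t+1)}`. [folklore] -/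
theorem budget_LMod (t : ℕ) : TMod hω (t + 1) ≤ (LMod hω t : ℝ) * (1 / 2 ^ (t + 1)) := by
  have h1 : TMod hω (t + 1) * 2 ^ (t + 1) ≤ (LMod hω t : ℝ) := by
    unfold LMod; push_cast
    exact (Nat.le_ceil _).trans (le_add_of_nonneg_right zero_le_one)
  rw [← mul_div_assoc, mul_one, le_div_iff₀ (by positivity)]
  exact h1

/-- The block BOUNDARIES: `N_0 = 0`, `N_{t+1} = N_t + L_t` (strictly increasing). [folklore] -/
def NMod : ℕ → ℕ
  | 0 => 0
  | t + 1 => NMod t + LMod hω t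

/-- `N` is strictly increasing in one step. [folklore] -/
theorem NMod_lt_succ (t : ℕ) : NMod hω t < NMod hω (t + 1) := by
  show NMod hω t < NMod hω t + LMod hω t
  have := one_le_LMod hω t; omega

/-- `N` is monotone. [folklore] -/
theorem NMod_mono : Monotone (NMod hω) :=
  monotone_nat_of_le_succ fun t => (NMod_lt_succ hω t).le

/-- `t ≤ N_t`. [folklore] -/
theorem le_NMod (t : ℕ) : t ≤ NMod hω t := by
  induction t with
  | zero => exact Nat.zero_le _
  | succ t ih => have := NMod_lt_succ hω t; omega

/-- Every index lies below some boundary. [folklore] -/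
theorem exists_lt_NMod (j : ℕ) : ∃ t : ℕ, j < NMod hω (t + 1) :=
  ⟨j, Nat.lt_of_le_of_lt (le_NMod hω j) (NMod_lt_succ hω j)⟩

/-- The BLOCK of index `j`: the least `t` with `j < N_{t+1}` (so `N_t ≤ j < N_{t+1}`). [folklore] -/
def blkMod (j : ℕ) : ℕ := Nat.find (exists_lt_NMod hω j)

/-- `j < N_{blk j + 1}`. [folklore] -/
theorem lt_NMod_blk (j : ℕ) : j < NMod hω (blkMod hω j + 1) := Nat.find_spec (exists_lt_NMod hω j)

/-- `N_{blk j} ≤ j`. [folklore] -/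
theorem NMod_blk_le (j : ℕ) : NMod hω (blkMod hω j) ≤ j := by
  rcases Nat.eq_zero_or_pos (blkMod hω j) with h0 | hpos
  · rw [h0]; exact Nat.zero_le _
  · obtain ⟨m, hm⟩ : ∃ m, blkMod hω j = m + 1 := ⟨blkMod hω j - 1, by omega⟩
    have hlt : m < blkMod hω j := by omega
    have hmin : ¬ j < NMod hω (m + 1) := Nat.find_min (exists_lt_NMod hω j) hlt
    rw [hm]; exact not_lt.mp hmin

/-- Indices of block `t`: `N_t ≤ j < N_{t+1} ⟹ blk j = t`. [folklore] -/
theorem blkMod_of_mem {j t : ℕ} (h1 : NMod hω t ≤ j) (h2 : j < NMod hω (t + 1)) : blkMod hω j = t := by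
  have hle : blkMod hω j ≤ t := Nat.find_min' (exists_lt_NMod hω j) h2
  rcases Nat.lt_or_eq_of_le hle with hlt | heq
  · exfalso
    have h3 := lt_NMod_blk hω j
    have h4 : NMod hω (blkMod hω j + 1) ≤ NMod hω t := NMod_mono hω (by omega)
    omega
  · exact heq

/-- Below block `t` the index is small: `blk j < t ⟹ j < N_t`. [folklore] -/
theorem lt_NMod_of_blkMod_lt {j t : ℕ} (h : blkMod hω j < t) : j < NMod hω t :=
  lt_of_lt_of_le (lt_NMod_blk hω j) (NMod_mono hω (by omega))

/-- THE `ω`-ADAPTED STAIRCASE · `b_j := −1∕2^{blk j}`. A TOY. [folklore] -/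
def bMod (j : ℕ) : ℝ := -(1 / 2 ^ blkMod hω j)

/-- **THE STAIRCASE HAS BOUNDED DRAWDOWN BELOW EVERY NEGATIVE LINE**: at threshold `ε > 0` pick `t` with `2^{−t} ≤ ε`; the terms of blocks `≥ t` lie
above the line, the `< N_t` earlier terms are each `≥ −1`. [folklore] -/
theorem dwSeq_neg_bMod {ε : ℝ} (hε : 0 < ε) : DwSeq (bMod hω) (-ε) := by
  obtain ⟨t, ht⟩ := exists_pow_lt_of_lt_one hε (show ((2 : ℝ)⁻¹) < 1 by norm_num)
  have hεt : 1 / (2 : ℝ) ^ t ≤ ε := by rw [one_div, ← inv_pow]; exact ht.le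
  refine ⟨NMod hω t, fun k n hkn => ?_⟩
  have hterm : ∀ j : ℕ, -(if j < NMod hω t then (1 : ℝ) else 0) ≤ bMod hω j - -ε := by
    intro j
    unfold bMod
    split_ifs with hj
    · have : 1 / (2 : ℝ) ^ blkMod hω j ≤ 1 := by
        rw [div_le_one (by positivity)]; exact one_le_pow₀ (by norm_num)
      linarith
    · have hbt : t ≤ blkMod hω j := not_lt.mp fun h => hj (lt_NMod_of_blkMod_lt hω h)
      have : 1 / (2 : ℝ) ^ blkMod hω j ≤ 1 / 2 ^ t :=
        one_div_le_one_div_of_le (by positivity) (pow_le_pow_right₀ (by norm_num) hbt)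
      linarith
  have hsum : -(∑ j ∈ Finset.Ico k n, (if j < NMod hω t then (1 : ℝ) else 0)) ≤ ∑ j ∈ Finset.Ico k n, (bMod hω j - -ε) := by
    rw [← Finset.sum_neg_distrib]; exact Finset.sum_le_sum fun j _ => hterm j
  have hcount : ∑ j ∈ Finset.Ico k n, (if j < NMod hω t then (1 : ℝ) else 0) ≤ NMod hω t := by
    rw [Finset.sum_ite, Finset.sum_const_zero, add_zero, Finset.sum_const, nsmul_eq_mul, mul_one]
    have h1 : ((Finset.Ico k n).filter (fun j => j < NMod hω t)).card ≤ (Finset.range (NMod hω t)).card :=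
      Finset.card_le_card fun j hj => by
        simp only [Finset.mem_filter, Finset.mem_Ico, Finset.mem_range] at hj ⊢
        exact hj.2
    rw [Finset.card_range] at h1
    exact_mod_cast h1
  linarith

/-- … hence the staircase is POSSIBLE over the every-slope class on every box. [cite: Balaban1987RG1, Thm 2 p.259 (first sentence) and Thm 3 p.264] -/
theorem endPossibleES_bMod {γc : ℝ} (hγc : 0 < γc) : EndPossibleES (bMod hω) γc :=
  (endPossibleES_iff_dwSeq_neg hγc).mpr fun _ hε => dwSeq_neg_bMod hω hε

/-! ## §4 The impossibility on every `C·ω` road -/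

/-- HELP BOUND on block `t` for the modulus `C·ω` with `C ≤ t + 1`: `T_t ≤ 1∕g²` ⟹ `C·ω(g) ≤ 2^{−(t+1)}` (half the block's rate). [folklore] -/
theorem help_le_of_TMod_le {C : ℝ} (hC : 0 < C) (t : ℕ) (hCt : C ≤ (t : ℝ) + 1) {g : ℝ} (hg : 0 < g) (hT : TMod hω t ≤ 1 / g ^ 2) :
    C * ω g ≤ 1 / 2 ^ (t + 1) := by
  obtain ⟨hs, -, hω2⟩ := sMod_spec hω t
  have h1 : g ^ 2 ≤ sMod hω t ^ 2 := by
    unfold TMod at hT; exact (one_div_le_one_div (pow_pos hs 2) (pow_pos hg 2)).mp hT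
  have h2 : g ≤ sMod hω t := (pow_le_pow_iff_left₀ hg.le hs.le two_ne_zero).mp h1
  have h3 : ω g ≤ ω (sMod hω t) := hω.mono _ _ hg h2
  have h4 : 0 < ω (sMod hω t) := hω.pos _ hs
  calc C * ω g ≤ C * ω (sMod hω t) := mul_le_mul_of_nonneg_left h3 hC.le
    _ ≤ ((t : ℝ) + 1) * ω (sMod hω t) := mul_le_mul_of_nonneg_right hCt h4.le
    _ ≤ (2 : ℝ)⁻¹ ^ (t + 1) := hω2
    _ = 1 / 2 ^ (t + 1) := by rw [inv_pow, one_div]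

/-- **THE STAIRCASE IS IMPOSSIBLE ON EVERY `C·ω` ROAD** · `0 < C`, `0 < γ₀`: NO realization of `b = bMod ω` with `|β¹_{k+1}| ≤ C·ω(g_k)` on the
`]0,γ₀]`-histories, (C), under ANY forward-generated construction, has `EndpointExistence`. [cite: Balaban1987RG1, (0.20) p.256 and Thm 2 p.259 (first sentence)] -/
theorem not_endPossibleMod_bMod {C γ₀ : ℝ} (hC : 0 < C) (hγ₀ : 0 < γ₀) : ¬ EndPossibleMod (bMod hω) (fun x => C * ω x) γ₀ := by
  rintro ⟨β, Sβ, Cn, hb, hAF, -, hgen, hE⟩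
  -- the first good block: C ≤ t₀ + 1
  obtain ⟨t₀, ht₀⟩ := exists_nat_ge C
  have hgood : ∀ t, t₀ ≤ t → C ≤ (t : ℝ) + 1 := fun t ht => by
    have : (t₀ : ℝ) ≤ t := by exact_mod_cast ht
    linarith
  have hs₀ := (sMod_spec hω t₀).1
  obtain ⟨γ₂, hγ₂, hγ⟩ := hE 0
  set γ : ℝ := min γ₂ (min γ₀ (sMod hω t₀)) with hγdef
  have hγpos : 0 < γ := lt_min hγ₂ (lt_min hγ₀ hs₀)
  have hγle₀ : γ ≤ γ₀ := (min_le_right _ _).trans (min_le_left _ _)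
  have hγles : γ ≤ sMod hω t₀ := (min_le_right _ _).trans (min_le_right _ _)
  obtain ⟨gstar, hgstar, hg⟩ := hγ γ hγpos (min_le_left _ _)
  -- a block boundary `t_K ≥ t₀` with `1∕g⋆² < T_{t_K + 1}`
  obtain ⟨tK, htK₀, htK⟩ : ∃ tK : ℕ, t₀ ≤ tK ∧ 1 / gstar ^ 2 < TMod hω (tK + 1) := by
    obtain ⟨n, hn⟩ := exists_nat_gt (1 / gstar ^ 2)
    refine ⟨max n t₀, le_max_right _ _, lt_of_lt_of_le hn ?_⟩
    have h1 : (n : ℝ) ≤ ((max n t₀ + 1 : ℕ) : ℝ) + 1 := by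
      have : n ≤ max n t₀ + 1 := (le_max_left _ _).trans (Nat.le_succ _)
      have : (n : ℝ) ≤ ((max n t₀ + 1 : ℕ) : ℝ) := by exact_mod_cast this
      linarith
    have h2 := sq_le_TMod hω (max n t₀ + 1)
    nlinarith [(Nat.cast_nonneg n : (0 : ℝ) ≤ n)]
  set K : ℕ := NMod hω (tK + 1) with hK
  obtain ⟨g0, hI, hend⟩ := hg gstar hgstar le_rfl K
  set P : B12.RunParams := ⟨K, 0, g0⟩ with hP
  have hposj : ∀ j, j ≤ K → 0 < (Cn P).flow.g j := fun j hj => (hI j hj).1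
  have hlej : ∀ j, j ≤ K → (Cn P).flow.g j ≤ γ := fun j hj => (hI j hj).2
  have hendK : 1 / ((Cn P).flow.g K) ^ 2 = 1 / gstar ^ 2 := by
    have h : (Cn P).flow.g K = gstar := hend
    rw [h]
  -- the one-sided staircase steps with the modulus help
  have hstep : ∀ i, i < K → 1 / ((Cn P).flow.g i) ^ 2 ≤ 1 / ((Cn P).flow.g (i + 1)) ^ 2 - 1 / 2 ^ blkMod hω i + C * ω ((Cn P).flow.g i) := by
    intro i hi
    have h1 := step_ge_of_forwardGenerated hgen P hI hi
    have hpre : prefixOf (Cn P).flow.g i ∈ B12Beta.HistBox γ₀ i := fun l =>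
      ⟨hposj l (by have := Fin.is_le l; omega), (hlej l (by have := Fin.is_le l; omega)).trans hγle₀⟩
    have h2 := (abs_le.mp (hAF i (prefixOf (Cn P).flow.g i) hpre)).2
    simp only [prefixOf_apply, Fin.val_last] at h2
    have h4 : β i (prefixOf (Cn P).flow.g i) = bMod hω i + Sβ.β1 i (prefixOf (Cn P).flow.g i) := by rw [Sβ.split i, hb i]
    rw [h4, bMod] at h1
    linarith
  -- block by block, from `t_K` down to `t₀`: at the left boundary `N_t` of block `t`, `1∕g² < T_t`
  have hBC : ∀ d, d ≤ tK - t₀ → 1 / ((Cn P).flow.g (NMod hω (tK - d))) ^ 2 < TMod hω (tK - d) := by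
    intro d
    induction d with
    | zero =>
      intro _
      rw [Nat.sub_zero]
      have hKle : NMod hω (tK + 1) ≤ K := le_rfl
      refine block_descent_gen (y := fun i => 1 / ((Cn P).flow.g i) ^ 2) (h := fun i => C * ω ((Cn P).flow.g i))
        (E := TMod hω (tK + 1)) (NMod_lt_succ hω tK).le (TMod_pos hω tK) (by positivity : (0 : ℝ) < 1 / 2 ^ tK)
        (fun i h1 h2 => by have := hstep i (by omega); rwa [blkMod_of_mem hω h1 h2] at this)
        (fun i _ h2 hT => by
          show C * ω ((Cn P).flow.g i) ≤ 1 / 2 ^ tK / 2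
          rw [div_div, ← pow_succ]
          exact help_le_of_TMod_le hω hC tK (hgood tK htK₀) (hposj i (by omega)) hT)
        ?_ ?_
      · have hb := budget_LMod hω tK
        have hlen : ((NMod hω (tK + 1) : ℕ) : ℝ) - (NMod hω tK : ℕ) = LMod hω tK := by
          show ((NMod hω tK + LMod hω tK : ℕ) : ℝ) - (NMod hω tK : ℕ) = LMod hω tK
          push_cast; ring
        rw [hlen]
        have e : (1 : ℝ) / 2 ^ tK / 2 = 1 / 2 ^ (tK + 1) := by rw [pow_succ]; ring
        rw [e]; exact hb
      · show 1 / ((Cn P).flow.g (NMod hω (tK + 1))) ^ 2 < TMod hω (tK + 1)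
        rw [← hK, hendK]; exact htK
    | succ d ih =>
      intro hd
      have ih' := ih (by omega)
      have ht1 : tK - d = tK - (d + 1) + 1 := by omega
      set t := tK - (d + 1) with htdef
      have hKle : NMod hω (t + 1) ≤ K := NMod_mono hω (by omega)
      refine block_descent_gen (y := fun i => 1 / ((Cn P).flow.g i) ^ 2) (h := fun i => C * ω ((Cn P).flow.g i))
        (E := TMod hω (t + 1)) (NMod_lt_succ hω t).le (TMod_pos hω t) (by positivity : (0 : ℝ) < 1 / 2 ^ t)
        (fun i h1 h2 => by have := hstep i (by omega); rwa [blkMod_of_mem hω h1 h2] at this)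
        (fun i _ h2 hT => by
          show C * ω ((Cn P).flow.g i) ≤ 1 / 2 ^ t / 2
          rw [div_div, ← pow_succ]
          exact help_le_of_TMod_le hω hC t (hgood t (by omega)) (hposj i (by omega)) hT)
        ?_ ?_
      · have hb := budget_LMod hω t
        have hlen : ((NMod hω (t + 1) : ℕ) : ℝ) - (NMod hω t : ℕ) = LMod hω t := by
          show ((NMod hω t + LMod hω t : ℕ) : ℝ) - (NMod hω t : ℕ) = LMod hω t
          push_cast; ring
        rw [hlen]
        have e : (1 : ℝ) / 2 ^ t / 2 = 1 / 2 ^ (t + 1) := by rw [pow_succ]; ring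
        rw [e]; exact hb
      · show 1 / ((Cn P).flow.g (NMod hω (t + 1))) ^ 2 < TMod hω (t + 1)
        rw [← ht1]; exact ih'
  have h0 := hBC (tK - t₀) le_rfl
  rw [show tK - (tK - t₀) = t₀ by omega] at h0
  -- but the box `γ ≤ s_{t₀}` puts `1∕g²` above `T_{t₀}` everywhere on the run
  have hidx : NMod hω t₀ ≤ K := NMod_mono hω (by omega)
  have hgi := hposj _ hidx
  have hgile : (Cn P).flow.g (NMod hω t₀) ≤ sMod hω t₀ := (hlej _ hidx).trans hγles
  have h1 : TMod hω t₀ ≤ 1 / ((Cn P).flow.g (NMod hω t₀)) ^ 2 := by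
    unfold TMod
    exact one_div_le_one_div_of_le (pow_pos hgi 2) (pow_le_pow_left₀ hgi.le hgile 2)
  linarith

end Stair

/-! ## §5 The separation, for every modulus -/

/-- **NO MODULUS CAPTURES EVERY-SLOPE POSSIBILITY** · for EVERY remainder modulus `ω` there is ONE one-loop sequence (the `ω`-adapted staircase)
POSSIBLE over the every-slope class on every box and IMPOSSIBLE over the class `|β¹| ≤ C·ω(g_k)` for EVERY `C > 0` and every box — whereas FORCING is
the same on all these roads (`EndDrawdownModulusRoad.endForcedMod_iff_endForcedES`). [cite: Balaban1987RG1, Thm 3 p.264 and (2.12)–(2.14) p.268] -/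
theorem everySlope_possible_not_modulus {ω : ℝ → ℝ} (hω : IsModulus ω) :
    ∃ b : ℕ → ℝ, (∀ γc : ℝ, 0 < γc → EndPossibleES b γc) ∧
      ∀ C γ₀ : ℝ, 0 < C → 0 < γ₀ → ¬ EndPossibleMod b (fun x => C * ω x) γ₀ :=
  ⟨bMod hω, fun _ hγc => endPossibleES_bMod hω hγc, fun _ _ hC hγ₀ => not_endPossibleMod_bMod hω hC hγ₀⟩

/-- ON EVERY MODULUS ROAD `∀ ε > 0, DwSeq b (−ε)` IS NECESSARY BUT NOT SUFFICIENT for possibility (the staircase), while it IS sufficient on the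
every-slope road: possibility over a modulus class reads the SIZE of the drawdown profile of `β⁰` against the modulus, not only its finiteness.
[folklore] -/
theorem dwSeq_neg_not_sufficient_modulus {ω : ℝ → ℝ} (hω : IsModulus ω) :
    ∃ b : ℕ → ℝ, (∀ ε : ℝ, 0 < ε → DwSeq b (-ε)) ∧ ∀ C γ₀ : ℝ, 0 < C → 0 < γ₀ → ¬ EndPossibleMod b (fun x => C * ω x) γ₀ :=
  ⟨bMod hω, fun _ hε => dwSeq_neg_bMod hω hε, fun _ _ hC hγ₀ => not_endPossibleMod_bMod hω hC hγ₀⟩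

end

end Summit.QuantumFields.BalabanUV.Gaps.EndDrawdownModulusStrict
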